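/-
Copyright (c) 2026. All rights reserved.
Released under Apache 2.0 license as described in the file LICENSE.
-/
import Literature.AlgebraicGeometry.ComplexMultiplication.HyperellipticJacobianExceptionalClasses
import HarnessLib

/-!
# `J_{27} = Jac(y² = x^{27} − 1)`: exactly `8` exceptional Hodge classes in codimension `2` (Goodson 2024, §5.4.2)

H. Goodson [Goodson2024DegeneracyFermat, §5.4.2]: «The Hodge ring of `J_{27}` is not worked out in Shioda's paper, but we can use
Theorem 5.2 of the paper to determine the exceptional cycles that appear in the Hodge ring.  For example, using code written in
Sage, we find that there are 8 exceptional cycles in codimension 2» (the eight classes `ω₁∧ω₁₀∧ω̄₃∧ω̄₈`, … are listed).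

## What is proved

`finrank_hodgeClassSpan_sub_finrank_divisorClassesSpan_twentySeven_two`: for every product `⨁_i A_i` of realisations of the
hyperelliptic (lower-half) CM types at the levels `27, 9, 3` (once each) — the CM data of `J_{27} ∼ X_{27} × X_9 × J_3` —
`dim_ℂ B² ⊗ ℂ − dim_ℂ D² ⊗ ℂ = 8`: the number of exceptional `(2,2)`-classes modulo divisor classes is EIGHT, Goodson's printed
count, obtained here by the companion file's `ncard_exceptional_eq_card_residues` (White's count read on residues: balanced
non-symmetric `4`-subsets of `ℤ/27 ∖ 0`) and kernel `decide` (≈ 50 s; `14950` subsets).  This file is kept separate from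
`HyperellipticJacobianExceptionalClasses` so that the long `decide` is not re-run with every edit of that file.

## Honest column / NOT here

As in the companion: the statement is about the CM data (realisations of the cyclotomic lower-half types), not about a
constructed Jacobian; the eight classes are counted, not identified with Goodson's differential forms; higher codimensions
of `J_{27}` and the Hodge group relations of §5.4.2 are not typed.

## References

* [Goodson2024DegeneracyFermat] H. Goodson, *An Exploration of Degeneracy in Abelian Varieties of Fermat Type*, Exp. Math.
  34 (2024), arXiv:2211.03909 — §5.4.2.
* [Gordon1999HodgeAVSurvey] B. B. Gordon, *A survey of the Hodge conjecture for abelian varieties* (1999), 9.2.2.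

[topic AlgebraicGeometry/ComplexMultiplication]
-/

noncomputable section

open NumberField
open CategoryTheory CategoryTheory.Limits
open Literature.NumberTheory.ComplexMultiplication
open Literature.AlgebraicGeometry.Motives (AbelianVariety CMType)
open Literature.AlgebraicGeometry.HodgeTheory
open Literature.AlgebraicGeometry.Pohlmann1968 Literature.AlgebraicGeometry.Pohlmann1968.Cyclotomic
open Literature.AlgebraicGeometry.Pohlmann1968.CMAlgebra
open Literature.AlgebraicGeometry.VanGeemen1994 (hodgeClassSpan)
open Literature.Barriers.HodgeConjecture (divisorClassesSpan)
open scoped DirectSum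

namespace Literature.AlgebraicGeometry.ComplexMultiplication

namespace HyperellipticJacobian

variable {k : ℕ} {lev : Fin k → ℕ} [∀ i, NeZero (lev i)] {K : Fin k → Type} [∀ i, Field (K i)]
  [∀ i, NumberField (K i)] [∀ i, IsCyclotomicExtension {lev i} ℚ (K i)] {Φ : ∀ i, CMType (K i)}
  {A : Fin k → AbelianVariety ℂ} {ι : ∀ i, 𝓞 (K i) →+* End (A i)}
  {θ : ∀ i, K i →+* Module.End ℂ (complexBetti (A i).X 1)}

set_option maxRecDepth 100000 in
set_option maxHeartbeats 8000000 in
/-- **`J_{27}`: EIGHT EXCEPTIONAL CLASSES IN CODIMENSION 2** («using code written in Sage, we find that there are 8 exceptional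
cycles in codimension 2»): for every product of realisations of the hyperelliptic types at the levels `27, 9, 3` (once each),
`dim_ℂ B² ⊗ ℂ − dim_ℂ D² ⊗ ℂ = 8`, by `decide` on the balanced non-symmetric `4`-subsets of `ℤ/27 ∖ 0`.
[cite: Goodson2024DegeneracyFermat, §5.4.2] [cite: Gordon1999HodgeAVSurvey, 9.2.2] -/
theorem finrank_hodgeClassSpan_sub_finrank_divisorClassesSpan_twentySeven_two (hdvd : ∀ i, lev i ∣ 27)
    (hinj : Function.Injective lev) (h2 : ∀ i, 2 < lev i) (hall : ∀ d, d ∣ 27 → 1 < d → ∃ i, lev i = d)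
    (hΦ : ∀ i (σ : K i →+* ℂ), σ ∈ (Φ i).1 ↔ 2 * (expOf (lev i) (K i) σ).val < lev i)
    (hA : ∀ i, IsCMTypeRealisation (Φ i) (A i) (ι i) (θ i)) :
    Module.finrank ℂ ↥(hodgeClassSpan (⨁ A).dim (⨁ A).X 2) -
        Module.finrank ℂ ↥(divisorClassesSpan (⨁ A).X (⨁ A).dim 2) = 8 := by
  rw [finrank_hodgeClassSpan_sub_finrank_divisorClassesSpan_of_levels (M := 27) (by decide) hdvd hinj h2 hΦ hA 2,
    ncard_exceptional_eq_card_residues (M := 27) hdvd hinj (fun i => lt_trans one_lt_two (h2 i)) hall hΦ 2]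
  decide

end HyperellipticJacobian

end Literature.AlgebraicGeometry.ComplexMultiplication
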